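import Mathlib
import Literature.MathematicalPhysics.QuantumManyBody.PeriodicBoseGas
import HarnessLib

/-!
# Boccato–Brennecke–Cenatiempo–Schlein (2019): the first Bogoliubov gap in the
Gross–Pitaevskii regime (Theorem 1.1, spectral part, lowest excitation), Ky-Fan form

Named fact (Literature is sorry-free; users take `(h : BoccatoEtAl2019_firstGap_GP)`).

Source: C. Boccato, C. Brennecke, S. Cenatiempo, B. Schlein, *Bogoliubov theory in the
Gross–Pitaevskii limit*, Acta Math. **222** (2019) 219–335 = arXiv:1801.01389
[cite: BoccatoEtAl2019Acta]. Setting (p. 3): `N` bosons on the unit torus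
`Λ = [-1/2,1/2]³`, `H_N = ∑ⱼ -Δ_{xⱼ} + ∑_{i<j} N² V(N(xᵢ - xⱼ))` on `L²_s(Λ^N)`,
`V ∈ L³(ℝ³)` non-negative, radial, compactly supported, scattering length `𝔞₀` of `V` through
`(-Δ + ½V) f = 0`, `f → 1` (eq. (1.2)–(1.3); units `-Δ`, i.e. `ħ = 2m = 1`, the tree's).

* **Theorem 1.1** (p. 3, verbatim second part): *"Moreover, the spectrum of `H_N - E_N` below a
  threshold `ζ` consists of eigenvalues given, in the limit `N → ∞`, by
  `∑_{p ∈ Λ*₊} n_p √(|p|⁴ + 16π𝔞₀p²) + O(N^{-1/4}(1 + ζ³))`. Here `n_p ∈ ℕ` for all `p ∈ Λ*₊`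
  and `n_p ≠ 0` for finitely many `p ∈ Λ*₊` only"*, `Λ*₊ = 2πℤ³ ∖ {0}`; made precise in the
  proof, §6 p. 31, eq. (6.2): with `λ_m` the `m`-th eigenvalue of `H_N - E_{M_N}` (unitarily
  `M_N - E_{M_N}`) and `ν_m` the `m`-th eigenvalue of `D = ∑ ε_p a_p* a_p`,
  `ε_p = (|p|⁴ + 16π𝔞₀p²)^{1/2}`, both counted with multiplicity,
  `|λ_m - ν_m| ≤ C N^{-1/4}(1 + ζ³)` for all `m ≥ 1` with `λ_m < ζ`, and `|λ₁| ≤ C N^{-1/4}`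
  (`ν₁ = 0`, `ν₂ = ε_{2π}`: the lowest momenta have `|p| = 2π`).
* p. 4: "Multiplying lengths by `N`, … the Gross–Pitaevskii regime considered in this paper is
  equivalent (up to a trivial rescaling) to an extended gas of `N` particles moving in a box with
  volume `N³` and interacting through a fixed potential `V` with scattering length `𝔞₀`".

Rendering (specialisation `m = 2`, `ζ = ε_{2π} + 2` of (6.2), in the tree's periodic-box
variables of `PeriodicBoseGas.lean`):
* the potential is a radial profile `v : ℝ → ℝ≥0∞` (`V(x) = v(|x|)`), measurable, of finite
  range `R₀`, with `∫ v(|x|)³ dx < ∞` (`V ∈ L³`; non-negativity and radiality are built in);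
* the theorem is applied to `V := ℓ² v(ℓ|·|)` (`ℓ > 0` a free length; same hypotheses, scattering
  length `a/ℓ`, `a = scatteringLength v`) and lengths are multiplied by `Nℓ`: the unit-torus
  operator `H_N` becomes `(Nℓ)⁻² ×` the periodic Hamiltonian of `N` bosons in the box of side
  `L = Nℓ` with the UNSCALED periodised pair potential `v^per` (`periodicEnergy v`,
  `periodizedPotential` = the paper's torus interaction, all images; `2R₀ < L` for `N` large);
  thus its first gap is `θ₂ - θ₁ = L⁻² (√((2π)⁴ + 16π(a/ℓ)(2π)²) + O(N^{-1/4}))`;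
* eigenvalues are rendered variationally (min-max / Ky Fan for the two lowest eigenvalues of a
  self-adjoint operator with compact resolvent on the Bose-symmetric space, over the `C¹`
  periodic Bose-symmetric form core `PeriodicTrialState N L` — the convention by which
  `periodicGroundStateEnergy = θ₁ = inf Spec`): `θ₁ + θ₂ = S₂ :=` the infimum of
  `periodicEnergy v Φ₁ + periodicEnergy v Φ₂` over pairs of trial states orthogonal in
  `L²([0,L)^{3N})`; the two printed inequalities `|(θ₂ - θ₁) - L⁻²ε| ≤ C L⁻² N^{-1/4}` are
  written in `ℝ≥0∞` without subtraction;
* `∃ C N₀` after `v, R₀, ℓ` (constants depend on the potential: the weakest reading).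

Not vendored here: the ground-state energy expansion (1.5) with the finite-box constant `e_Λ`,
the higher excited levels, the eigenvector approximation (6.7)–(6.8) and the depletion (1.7).

Grounds (as an explicit GP-regime hypothesis, the nearest printed theorem) the Bogoliubov-gap
cruxes of the BoseEinsteinCondensation sub-problem:
`Summit.AtomisticToContinuum.BoseEinsteinCondensation.Theses.BECNudgeWalk.NudgeGap`
(stmt-AtomisticToContinuum-14359, FACT WANTED by grounder g26-12),
`…Theses.BECNoCheapMomentum.SectorGapFloor` (stmt-11843), `…Theses.BECRewardDescent.SectorGap`
(stmt-12874); those items ask for the thermodynamic box `L = (N/ρ)^{1/3}`, which is STRONGER than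
print (here `ρ = N/L³ = N⁻²ℓ⁻³ → 0`).
-/

noncomputable section

namespace Literature.MathematicalPhysics.QuantumManyBody.BoseGas

open _root_.MeasureTheory
open scoped ENNReal NNReal ComplexConjugate

/-- **Boccato–Brennecke–Cenatiempo–Schlein 2019, Theorem 1.1 (first excited level), Ky-Fan form
in box variables.** For every measurable radial pair-potential profile `v ≥ 0` of finite range
`R₀` with `∫_{ℝ³} v(|x|)³ dx < ∞` and every length `ℓ > 0` there are `C` and `N₀` such that for
all `N ≥ N₀`, in the periodic box of side `L = Nℓ` (Gross–Pitaevskii scaling): writing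
`a = scatteringLength v`, `ε = √((2π)⁴ + 16π (a/ℓ) (2π)²)` (Bogoliubov dispersion
`√(|p|⁴ + 16π𝔞₀p²)` at the lowest momentum `|p| = 2π`, `𝔞₀ = a/ℓ`) and
`S₂ = inf {⟨Φ₁,HΦ₁⟩ + ⟨Φ₂,HΦ₂⟩ : Φ₁ ⊥ Φ₂ periodic Bose trial states}` (`= θ₁ + θ₂`, the two lowest
eigenvalues of `H = ∑ⱼ -Δⱼ + ∑_{i<j} v^per(xᵢ - xⱼ)` on the Bose space, by Ky Fan), the first
spectral gap `θ₂ - θ₁ = S₂ - 2E₀` satisfies `|θ₂ - θ₁ - ε/L²| ≤ C N^{-1/4}/L²`, i.e.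
`S₂ ≤ 2E₀ + (ε + C N^{-1/4})/L²` and `2E₀ + ε/L² ≤ S₂ + C N^{-1/4}/L²`
(`E₀ = periodicGroundStateEnergy v N L = θ₁`).
[cite: BoccatoEtAl2019Acta, Thm 1.1 (p. 3) with §6 eq. (6.2) p. 31 (m = 2, ζ = ε + 2) and the rescaling remark p. 4] -/
def BoccatoEtAl2019_firstGap_GP : Prop :=
  ∀ (v : ℝ → ℝ≥0∞) (R₀ ℓ : ℝ), Measurable v → (∀ r, R₀ < r → v r = 0) →
    (∫⁻ x : Space, v ‖x‖ ^ 3) ≠ ⊤ → 0 < ℓ →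
    ∃ (C : ℝ) (N₀ : ℕ), ∀ N : ℕ, N₀ ≤ N →
      let L : ℝ := (N : ℝ) * ℓ
      let a : ℝ := (scatteringLength v).toReal
      let ε : ℝ := Real.sqrt ((2 * Real.pi) ^ 4 + 16 * Real.pi * (a / ℓ) * (2 * Real.pi) ^ 2)
      let S₂ : ℝ≥0∞ :=
        ⨅ (Φ₁ : PeriodicTrialState N L) (Φ₂ : PeriodicTrialState N L)
          (_ : ∫ X in cellN N L, conj (Φ₁.ψ X) * Φ₂.ψ X = 0),
          periodicEnergy v Φ₁ + periodicEnergy v Φ₂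
      S₂ ≤ 2 * periodicGroundStateEnergy v N L +
          ENNReal.ofReal ((ε + C * (N : ℝ) ^ (-(1 : ℝ) / 4)) / L ^ 2) ∧
      2 * periodicGroundStateEnergy v N L + ENNReal.ofReal (ε / L ^ 2) ≤
          S₂ + ENNReal.ofReal (C * (N : ℝ) ^ (-(1 : ℝ) / 4) / L ^ 2)

#harness_tags BoccatoEtAl2019_firstGap_GP

end Literature.MathematicalPhysics.QuantumManyBody.BoseGas

end
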